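import Summits.AtomisticToContinuum.Crystallization.Theorems.MinimiserShells.Negative.MultRooted

/-!
# Negative knowledge for crux `MinimiserShells` (stmt-AtomisticToContinuum-9225) — the NORMALISATION of
# the law and the UNIT MASS of atoms are load-bearing (standing disprover, gen 2)

Two mutations of the hypotheses of `PalmUnimodularRigidity.MinimiserShells`, each certified FALSE by
an explicit law built on the DIMER `{0, u₀}` (`pair`: two particles at the optimal distance `1`,
`interactionEnergy_pair = −1/12`, so the uniformly rooted dimer has mean root energy `−1/24` and every
shell has ONE point, `not_goodShell_of_subsingleton`):

* `minimiserShells_false_without_normalisation` — `IsProbabilityMeasure P` weakened to "`P` finite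
  and non-zero": FALSE for `n • P_dimer`, `n = ⌈−24 e*⌉₊ + 1` (`mult`).  The energy hypothesis
  `E_P[h] ≤ e*` is `1`-homogeneous in `P`, the conclusion `0`-homogeneous.
* `minimiserShells_false_without_unitMass` — the clause `μ = count|S` relaxed to a common integer
  multiplicity `μ = k • count|S`, `k ≥ 1` (`IsRootedHardCoreMult`; the multiplicities `m ≥ 1` that
  vague limits of empirical measures carry, cf. `IsCrystallizing`): FALSE for the uniformly rooted dimer
  with atom mass `n` (`MultRooted.multRooted`: Mecke survives `μ ↦ k • μ`, the energy is multiplied by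
  `k`, shells are unchanged).  So a proof must use that every atom carries unit mass — "one unit of
  probability per particle" — which no constraint linear in `μ` (two-point data, Mecke identities)
  expresses.

Supports item stmt-AtomisticToContinuum-9225; workfile `Cruxes/MinimiserShells/Disproof.lean` §6a–b.
-/

noncomputable section

open MeasureTheory
open scoped ENNReal BigOperators

namespace Summit.AtomisticToContinuum.Crystallization.Theorems.MinimiserShells.Negative.Normalisation

open Literature.Probability.Process
open Literature.MathematicalPhysics.StatisticalMechanics
open Literature.Geometry.DiscreteGeometry
open Summit.AtomisticToContinuum.Crystallization.Theses.PalmUnimodularRigidity (MinimiserShells)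
open Summit.AtomisticToContinuum.Crystallization.Theorems.MinimiserShells.Negative.LoadBearing
  (eStar meanRootEnergy GoodShell not_goodShell_of_far e0 combPt combSize
    norm_combPt le_norm_combPt norm_combPt_le combPt_ne_zero combPt_injective dist_combPt
    lennardJones_le_on_comb_annulus ae_eq_dirac_count_restrict meanRootEnergy_dirac_count_restrict)
open Summit.AtomisticToContinuum.Crystallization.Theorems.MinimiserShells.Negative.UniformRooting
  (rootedAt rootedMeasure unifRooted isProbabilityMeasure_unifRooted lintegral_rootedMeasure
    map_sub_rootedMeasure isPointStationaryLaw_unifRooted isRootedHardCore_rootedMeasure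
    ae_isRootedHardCore_unifRooted meanRootEnergy_unifRooted integral_unifRooted
    ae_eq_dirac_rootedMeasure)

open Summit.AtomisticToContinuum.Crystallization.Theorems.MinimiserShells.Negative.MultRooted
  (multRooted isProbabilityMeasure_multRooted ae_eq_dirac_smul_rootedMeasure
    isPointStationaryLaw_multRooted meanRootEnergy_multRooted)

/-- Euclidean 3-space. -/
abbrev E3 := EuclideanSpace ℝ (Fin 3)

/-! ## Shell bookkeeping: at most one non-root atom is never a good shell -/

/-- If the configuration has at most one atom besides the root, its shell is bad (a good shell has
twelve points). [folklore] -/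
theorem not_goodShell_of_subsingleton {μ : Measure E3}
    (h : ({y : E3 | μ {y} ≠ 0 ∧ y ≠ 0} : Set E3).Subsingleton) : ¬ GoodShell μ := by
  rintro ⟨a, ha₁, ha₂, T, hT, hclose⟩
  have ha0 : a ≠ 0 := by linarith
  have hcard : T.card = 12 := by
    rcases hclose with hc | hc
    · rw [hc.card_eq, Finset.card_image_of_injective _ (smul_right_injective E3 ha0),
        card_fccKissingPattern]
    · rw [hc.card_eq, Finset.card_image_of_injective _ (smul_right_injective E3 ha0),
        card_hcpKissingPattern]
  have hle : T.card ≤ 1 := by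
    refine Finset.card_le_one.2 fun s hs t ht => h ?_ ?_
    · have := (Set.ext_iff.1 hT s).1 (Finset.mem_coe.2 hs)
      exact ⟨this.1, this.2.1⟩
    · have := (Set.ext_iff.1 hT t).1 (Finset.mem_coe.2 ht)
      exact ⟨this.1, this.2.1⟩
  omega

/-! ## The two-point cluster `{0, u₀}` at the optimal distance `1` -/

/-- The unit vector `u₀ = e₁`. -/
def u0 : E3 := EuclideanSpace.single 0 1

/-- `‖u₀‖ = 1`. [folklore] -/
theorem norm_u0 : ‖u0‖ = 1 := by simp [u0]

/-- `u₀ ≠ 0`. [folklore] -/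
theorem u0_ne_zero : u0 ≠ 0 := by
  intro h; have := norm_u0; rw [h, norm_zero] at this; exact zero_ne_one this

/-- The dimer: root at `0`, partner at `u₀`. -/
def pair : Fin 2 → E3 := ![0, u0]

/-- First dimer point. [folklore] -/
@[simp] theorem pair_zero : pair 0 = 0 := rfl
/-- Second dimer point. [folklore] -/
@[simp] theorem pair_one : pair 1 = u0 := rfl

/-- The dimer points are distinct. [folklore] -/
theorem pair_injective : Function.Injective pair := by
  intro i j h
  fin_cases i <;> fin_cases j
  · rfl
  · exact absurd h.symm (by simpa using u0_ne_zero)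
  · exact absurd h (by simpa using u0_ne_zero)
  · rfl

/-- The dimer is `1`-separated. [folklore] -/
theorem pair_separated : ∀ k l : Fin 2, k ≠ l → (1 : ℝ) ≤ dist (pair k) (pair l) := by
  intro k l hkl
  fin_cases k <;> fin_cases l
  · exact absurd rfl hkl
  · simp [dist_eq_norm, norm_u0]
  · simp [dist_eq_norm, norm_u0]
  · exact absurd rfl hkl

/-- Its interaction energy is `V_LJ(1) = -1/12`. [folklore] -/
theorem interactionEnergy_pair : interactionEnergy lennardJones pair = -1 / 12 := by
  have h0 : Finset.Ioi (0 : Fin 2) = {1} := by decide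
  have h1 : Finset.Ioi (1 : Fin 2) = ∅ := by decide
  rw [interactionEnergy, Fin.sum_univ_two, h0, h1, Finset.sum_singleton, Finset.sum_empty, add_zero,
    pair_zero, pair_one, dist_eq_norm, zero_sub, norm_neg, norm_u0, lennardJones_one]

/-- Seen from either particle, the dimer has exactly one atom besides the root. [folklore] -/
theorem subsingleton_atoms_rootedMeasure_pair (i : Fin 2) {w : ℝ≥0∞} :
    ({y : E3 | (w • rootedMeasure pair i) {y} ≠ 0 ∧ y ≠ 0} : Set E3).Subsingleton := by
  intro y hy z hz
  simp only [Set.mem_setOf_eq, Measure.smul_apply, smul_eq_mul, ne_eq, mul_eq_zero, not_or] at hy hz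
  have hy' := (count_restrict_singleton_ne_zero_iff _ y).1 hy.1.2
  have hz' := (count_restrict_singleton_ne_zero_iff _ z).1 hz.1.2
  rw [Finset.mem_coe, rootedAt, Finset.mem_image] at hy' hz'
  obtain ⟨k, -, rfl⟩ := hy'
  obtain ⟨l, -, rfl⟩ := hz'
  have hk : k ≠ i := fun h => hy.2 (by rw [h, sub_self])
  have hl : l ≠ i := fun h => hz.2 (by rw [h, sub_self])
  have : k = l := by omega
  rw [this]

/-! ## §6a `IsProbabilityMeasure P` is load-bearing (not just finiteness): `P ↦ c • P` -/

/-- The multiple that beats `e*`: `n(e*) = ⌈-24 e*⌉₊ + 1 ≥ 1` (whatever the real number `e*` is). -/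
def mult : ℕ := ⌈-24 * eStar⌉₊ + 1

/-- `n(e*) ≥ 1`. [folklore] -/
theorem one_le_mult : 1 ≤ mult := Nat.le_add_left 1 _

/-- `−n(e*)/24 ≤ e*`. [folklore] -/
theorem mult_energy_le : (mult : ℝ) * (-1 / 24) ≤ eStar := by
  have h : -24 * eStar ≤ (⌈-24 * eStar⌉₊ : ℝ) := Nat.le_ceil _
  have hm : (mult : ℝ) = (⌈-24 * eStar⌉₊ : ℝ) + 1 := by simp [mult]
  rw [hm]
  rcases le_or_gt eStar (1 / 24) with he | he
  · nlinarith
  · have : (0 : ℝ) ≤ (⌈-24 * eStar⌉₊ : ℝ) := Nat.cast_nonneg _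
    nlinarith

/-- Mean root energy of the uniformly rooted dimer: `E(2)/2`-type identity, `= -1/24`. [folklore] -/
theorem meanRootEnergy_unifRooted_pair : meanRootEnergy (unifRooted pair) = -1 / 24 := by
  rw [meanRootEnergy_unifRooted pair_injective, interactionEnergy_pair]
  norm_num

/-- **Any proof must use `P univ = 1`, not merely `P` finite non-zero**: the energy hypothesis is
`1`-homogeneous in `P`, the conclusion `0`-homogeneous. Witness: `n • P_dimer`, `P_dimer` the
uniformly rooted dimer `{0, u₀}` (point-stationary, `1`-hard-core, energy `-1/24`, every shell has ONE
point), `n = ⌈-24e*⌉₊ + 1`. [folklore] -/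
theorem minimiserShells_false_without_normalisation :
    ¬ (∀ δ : ℝ, 0 < δ → ∀ P : Measure (Measure E3), IsFiniteMeasure P → P ≠ 0 →
      (∀ᵐ μ ∂P, IsRootedHardCore δ μ) → IsPointStationaryLaw P → meanRootEnergy P ≤ eStar →
      ∀ᵐ μ ∂P, GoodShell μ) := by
  intro h
  set P : Measure (Measure E3) := unifRooted pair with hP
  haveI : IsProbabilityMeasure P := isProbabilityMeasure_unifRooted pair
  set P' : Measure (Measure E3) := (mult : ℝ≥0∞) • P with hP'
  have hfin : IsFiniteMeasure P' := ⟨by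
    rw [hP', Measure.smul_apply, smul_eq_mul, measure_univ, mul_one]
    exact ENNReal.natCast_lt_top mult⟩
  have hne : P' ≠ 0 := by
    intro h0
    have := congrArg (fun Q : Measure (Measure E3) => Q Set.univ) h0
    simp only [hP', Measure.smul_apply, smul_eq_mul, measure_univ, mul_one, Measure.coe_zero,
      Pi.zero_apply, Nat.cast_eq_zero] at this
    exact absurd this (by have := one_le_mult; omega)
  have hcore : ∀ᵐ μ ∂P', IsRootedHardCore 1 μ :=
    Measure.ae_smul_measure (ae_isRootedHardCore_unifRooted pair_separated) _
  have hstat : IsPointStationaryLaw P' := (isPointStationaryLaw_unifRooted pair_injective).smul _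
  have hE : meanRootEnergy P' ≤ eStar := by
    have : meanRootEnergy P' = (mult : ℝ) * (-1 / 24) := by
      rw [show meanRootEnergy P' = ∫ μ, (∫ y, lennardJones ‖y‖ ∂μ) / 2 ∂P' from rfl, hP',
        integral_smul_measure, ENNReal.toReal_natCast, smul_eq_mul]
      exact congrArg _ meanRootEnergy_unifRooted_pair
    rw [this]
    exact mult_energy_le
  have hgood := h 1 one_pos P' hfin hne hcore hstat hE
  -- but under `P'` every configuration is a rooted dimer with ONE non-root atom
  have hgoodP : ∀ᵐ μ ∂P, GoodShell μ := by
    have hm0 : (mult : ℝ≥0∞) ≠ 0 := by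
      have := one_le_mult; exact_mod_cast (by omega : mult ≠ 0)
    exact (Measure.ae_ennreal_smul_measure_iff hm0).1 hgood
  have hbad : ∀ᵐ μ ∂P, ¬ GoodShell μ := by
    rw [hP, unifRooted]
    refine Measure.ae_smul_measure ?_ _
    have hi : ∀ i : Fin 2, ∀ᵐ μ ∂(Measure.dirac (rootedMeasure pair i) : Measure (Measure E3)),
        ¬ GoodShell μ := fun i =>
      (ae_eq_dirac_rootedMeasure pair i).mono fun μ hμ => by
        rw [hμ]
        have := subsingleton_atoms_rootedMeasure_pair i (w := 1)
        rw [one_smul] at this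
        exact not_goodShell_of_subsingleton this
    rw [ae_iff]
    simp only [Measure.coe_finsetSum, Finset.sum_apply, Finset.sum_eq_zero_iff, Finset.mem_univ,
      true_imp_iff]
    exact fun i => ae_iff.1 (hi i)
  obtain ⟨μ, h1, h2⟩ := (hgoodP.and hbad).exists
  exact h2 h1


/-! ## §6b The unit-mass clause of hypothesis (i) is load-bearing: `μ ↦ k • μ`

Hypothesis (i) says `μ = count|S` — every atom has mass EXACTLY `1`.  Relax it to "every atom has the
same integer mass `k ≥ 1`" (`IsRootedHardCoreMult`; these ARE the vague limits of empirical measures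
the summit's `IsCrystallizing` allows, multiplicities `m ≥ 1`) and the crux becomes FALSE: the image of
a point-stationary law under `μ ↦ k • μ` is point-stationary, its energy is multiplied by `k`, its
shells are unchanged.  So any proof must use unit masses — the formal shadow of "one unit of
probability per particle": `E_P[h]` is linear in `μ`, `P(bad)` is not. -/

/-- Rooted `δ`-hard-core configuration WITH A COMMON INTEGER MULTIPLICITY: `μ = k • count|S` for a
`δ`-separated `S ∋ 0` and an integer `k ≥ 1` (`k = 1` is `IsRootedHardCore`). -/
def IsRootedHardCoreMult (δ : ℝ) (μ : Measure E3) : Prop :=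
  ∃ S : Set E3, (0 : E3) ∈ S ∧ (∀ x ∈ S, ∀ y ∈ S, x ≠ y → δ ≤ dist x y) ∧
    ∃ k : ℕ, 1 ≤ k ∧ μ = (k : ℝ≥0∞) • (Measure.count : Measure E3).restrict S

/-- Unit mass is the case `k = 1`. [folklore] -/
theorem isRootedHardCoreMult_of_isRootedHardCore {δ : ℝ} {μ : Measure E3}
    (h : IsRootedHardCore δ μ) : IsRootedHardCoreMult δ μ := by
  obtain ⟨S, h0, hsep, rfl⟩ := h
  exact ⟨S, h0, hsep, 1, le_rfl, by rw [Nat.cast_one, one_smul]⟩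


/-- **Any proof must use unit atom masses.** Witness: the uniformly rooted dimer with every atom
of mass `n = ⌈-24e*⌉₊ + 1`: a probability law, point-stationary, carried by `n • count|S` with `S`
rooted and `1`-separated, energy `-n/24 ≤ e*`, and every shell has ONE point. [folklore] -/
theorem minimiserShells_false_without_unitMass :
    ¬ (∀ δ : ℝ, 0 < δ → ∀ P : Measure (Measure E3), IsProbabilityMeasure P →
      (∀ᵐ μ ∂P, IsRootedHardCoreMult δ μ) → IsPointStationaryLaw P → meanRootEnergy P ≤ eStar →
      ∀ᵐ μ ∂P, GoodShell μ) := by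
  intro h
  set P : Measure (Measure E3) := multRooted (mult : ℝ≥0∞) pair with hP
  haveI : IsProbabilityMeasure P := isProbabilityMeasure_multRooted _ pair
  have hcomp : ∀ i : Fin 2, ∀ᵐ μ ∂(Measure.dirac ((mult : ℝ≥0∞) • rootedMeasure pair i) :
      Measure (Measure E3)), IsRootedHardCoreMult 1 μ ∧ ¬ GoodShell μ := fun i =>
    (ae_eq_dirac_smul_rootedMeasure _ pair i).mono fun μ hμ => by
      rw [hμ]
      refine ⟨?_, not_goodShell_of_subsingleton (subsingleton_atoms_rootedMeasure_pair i)⟩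
      obtain ⟨S, h0, hsep, hS⟩ := isRootedHardCore_rootedMeasure pair_separated i
      exact ⟨S, h0, hsep, mult, one_le_mult, by rw [hS]⟩
  have hboth : ∀ᵐ μ ∂P, IsRootedHardCoreMult 1 μ ∧ ¬ GoodShell μ := by
    rw [hP, multRooted]
    refine Measure.ae_smul_measure ?_ _
    rw [ae_iff]
    simp only [Measure.coe_finsetSum, Finset.sum_apply, Finset.sum_eq_zero_iff, Finset.mem_univ,
      true_imp_iff]
    exact fun i => ae_iff.1 (hcomp i)
  have hstat : IsPointStationaryLaw P := isPointStationaryLaw_multRooted pair_injective _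
  have hE : meanRootEnergy P ≤ eStar := by
    rw [hP, meanRootEnergy_multRooted pair_injective, interactionEnergy_pair, ENNReal.toReal_natCast]
    have := mult_energy_le
    push_cast
    linarith
  have hgood := h 1 one_pos P inferInstance (hboth.mono fun μ hμ => hμ.1) hstat hE
  obtain ⟨μ, h1, h2⟩ := (hgood.and hboth).exists
  exact h2.2 h1



end Summit.AtomisticToContinuum.Crystallization.Theorems.MinimiserShells.Negative.Normalisation
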